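import Summits.QuantumFields.BalabanUV.T4Continuum.Support.CovariantVectorChartConjugation

/-!
# T⁴ programme, SUBSTRATE (shared lattice-gauge analysis library) — CONJUGATION DEFECTS OF THE CHART PIECES, II (averaging): the averaging
# perturbation `a′n^d·(Qᴬ((R⁰)⁻¹e^{−A})·Q(e^{A}R⁰) − Q(R⁰)ᴴQ(R⁰))` of the two-sided fluctuation operator along the exponential chart has a
# Combes–Thomas conjugation defect `≤ a′·|o|²·θ_L·E·(2 + θ_L)·(6 + E)` — first order in the weight (`θ_L = e^{|κ|L} − 1`) and in the chart
# modulus (`E = (1 + ‖A‖e^{‖A‖})^ℓ − 1`), LEVEL-FREE (typer LIBRARY-v0.1 item W-9 ∕ L-A7, file 2 of 4)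

Substrate cell `b2b-balaban-substrate-*`, seat p3 (gen 2).  The averaging `Q(R)` maps fine coloured bond fields to coarse ones; its conjugation
`W_σ Q(R) W_ρ⁻¹` is taken with a COARSE intermediate weight `σ` on `Tor M × Fin d` within `L` of the fine weight `ρ` on every block stencil
(`qr(b, i) ≠ 0 → |σ b − ρ i| ≤ L`; for the distance-to-the-source weight of `DeltaACombesThomasSets` one takes `σ b := ρ` at a stencil point and
`L = 2(d+1)` by `stencil_osc_of_lipschitz` — file 3 `CovariantVectorGreenDecayChart`), and the rectangular Schur test on the `qr` pattern
(`DeltaACombesThomas.sum_qr_row ∕ sum_qr_col`: rows `|o|ε`, columns `|o|ε·n^{−d}`) gives every bound: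
 * `opNorm_le_of_qr_majorant` (`‖X b i‖ ≤ ε·qr ⇒ ‖X‖ ≤ |o|·ε·n^{−d/2}`) and **`opNorm_conjMat_sub_le_of_qr_majorant`**
   (`⇒ ‖W_σXW_ρ⁻¹ − X‖ ≤ (e^{|κ|L} − 1)·|o|·ε·n^{−d/2}`), with the fine × coarse twins (`…'`, by `CTConjugationPieces.conjMat_conjTranspose`);
 * `opNorm_conjMat_mul_sub_le` (defect of a product from defects and sizes of the factors), `norm_transport_sub_one_le_two`,
   **`chart_entry_majorants`** (entries of `Q(R⁰)`, `Q(e^{A}R⁰) − Q(R⁰)`, `Q(e^{A}R⁰)`, `Q(R⁰)ᴴ`, `Qᴬ((R⁰)⁻¹e^{−A}) − Q(R⁰)ᴴ` against `3·qr`, `E·qr`,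
   `(3 + E)·qr`, `3·qr`, `E·qr` — `CovariantVectorCTDefects.norm_Qcov_apply_le` and `CovariantVectorChartModulus.norm_Qcov_sub_Qcov_apply_le` BY NAME);
 * **`opNorm_conjMat_avg_sub_le`** (`≤ n^{−d}·|o|²·θ_L·E·(2 + θ_L)·(6 + E)`: the `n^{−d}` is what the mass prefactor `a′n^d` pays for) and
   **`conjDefect_avg_chart`** (`ConjDefect (a′n^d·(…)) κ ρ (a′·|o|²·θ_L·E·(2 + θ_L)·(6 + E))`).
HONEST FRAMING (T4-DAG p. 1).  MODEL-level finite-dimensional linear algebra ([folklore]; constants OURS and crude); no estimate of any NE row;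
nothing printed is a hypothesis; no `def`; spine 0/9 unchanged; NOT infinite volume ∕ mass gap ∕ Clay.  HONEST DEPENDENCY: continuum YM on
T⁴ ⇐ BetaPertH ∧ nine spine estimates (0/9 proved); BetaPertH ⇐ (D1) ∧ (D4) ∧ CAP+tail; G-an2-4 gates asym, D1 and NE2/3/4.  ABSOLUTE RULE kept;
no `sorry`.
-/

noncomputable section

open scoped BigOperators ComplexConjugate Matrix Matrix.Norms.L2Operator Kronecker ComplexOrder

namespace Summit.QuantumFields.BalabanUV.T4Continuum.CovariantVectorChartConjugationAvg

open Literature.MathematicalPhysics.QuantumFieldTheory.Balaban1983to89.B5Prop11Plancherel (Tor fine unitVec shiftM)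
open Literature.MathematicalPhysics.QuantumFieldTheory.Balaban1983to89.B5Block118 (bpt tstep)
open Literature.MathematicalPhysics.QuantumFieldTheory.Balaban1983to89.Beta.DeltaACombesThomas (qr qr_nonneg qr_ne_zero sum_qr_row sum_qr_col)
open Summit.QuantumFields.BalabanUV.T4Continuum
open Summit.QuantumFields.BalabanUV.T4Continuum.BlockMultiplication (siteMul siteMul_apply siteMul_sub siteMul_one siteMul_mul opNorm_siteMul_le)
open Summit.QuantumFields.BalabanUV.T4Continuum.KroneckerUnits (norm_entry_le)
open Summit.QuantumFields.BalabanUV.T4Continuum.ColourCovariantLaplacian (covDc covLapC)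
open Summit.QuantumFields.BalabanUV.T4Continuum.CovariantBlockAveraging (transport ContourSystem Qcov opNorm_le_sqrt_of_schur)
open Summit.QuantumFields.BalabanUV.T4Continuum.SubstrateTransporterSpecies
open Summit.QuantumFields.BalabanUV.T4Continuum.CovariantVectorCTDefects (rhoV norm_Qcov_apply_le)
open Summit.QuantumFields.BalabanUV.T4Continuum.CovariantVectorChartModulus
open Summit.QuantumFields.BalabanUV.T4Continuum.CovariantVectorChartFactorisation
open Summit.QuantumFields.BalabanUV.T4Continuum.CovariantVectorCoerciveHoloForm (opNorm_Mfac_sub_one_le opNorm_Nfac_sub_one_le opNorm_le_one_add)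
open Summit.QuantumFields.BalabanUV.T4Continuum.CTWeightedCoercivity (conjMat conjMat_apply conjMat_add conjMat_sub conjMat_smul conjMat_mul conjMat_one
  ConjDefect conjDefect_of_opNorm)
open Summit.QuantumFields.BalabanUV.T4Continuum.CTConjugationPieces (conjMat_conjTranspose opNorm_conjMat_sub_le_schur)
open Summit.QuantumFields.BalabanUV.T4Continuum.CovariantVectorChartConjugation

variable {d : ℕ} {o : Type*} [Fintype o] [DecidableEq o] [Nonempty o]

/-! ## §1 Schur on the `qr` pattern with a coarse intermediate weight; the averaging chart perturbation -/

section Averaging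

variable (n : ℕ) [NeZero n] (M : Fin d → ℕ) [hM : ∀ μ, NeZero (M μ)]
variable {ρ : Tor (fine n M) × Fin d → ℝ} {σ : Tor M × Fin d → ℝ} {κ L : ℝ}

omit [Nonempty o] in
/-- **Schur on the `qr` pattern** (coarse × fine): `‖X b i‖ ≤ ε·qr(b₁, i₁)` ⇒ `‖X‖ ≤ |o|·ε·n^{−d/2}` (rows `|o|ε`, columns `|o|ε n^{−d}`). [folklore] -/
theorem opNorm_le_of_qr_majorant (X : Matrix ((Tor M × Fin d) × o) ((Tor (fine n M) × Fin d) × o) ℂ) {ε : ℝ} (hε : 0 ≤ ε)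
    (hX : ∀ b i, ‖X b i‖ ≤ ε * qr n M b.1 i.1) : ‖X‖ ≤ Fintype.card o * ε * (Real.sqrt ((n : ℝ) ^ d))⁻¹ := by
  have hn : (0 : ℝ) < (n : ℝ) ^ d := pow_pos (by exact_mod_cast Nat.pos_of_ne_zero (NeZero.ne n)) d
  have hrow : ∀ b : (Tor M × Fin d) × o, ∑ i : (Tor (fine n M) × Fin d) × o, ‖X b i‖ ≤ Fintype.card o * ε := by
    intro b
    calc _ ≤ ∑ i : (Tor (fine n M) × Fin d) × o, ε * qr n M b.1 i.1 := Finset.sum_le_sum fun i _ => hX b i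
      _ = Fintype.card o * ε := by
          rw [Fintype.sum_prod_type, Finset.sum_comm]
          simp only [Finset.sum_const, Finset.card_univ, nsmul_eq_mul, ← Finset.mul_sum]
          rw [sum_qr_row, mul_one]
  have hcol : ∀ i : (Tor (fine n M) × Fin d) × o, ∑ b : (Tor M × Fin d) × o, ‖X b i‖ ≤ Fintype.card o * ε * (1 / (n : ℝ) ^ d) := by
    intro i
    calc _ ≤ ∑ b : (Tor M × Fin d) × o, ε * qr n M b.1 i.1 := Finset.sum_le_sum fun b _ => hX b i
      _ = Fintype.card o * ε * (1 / (n : ℝ) ^ d) := by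
          rw [Fintype.sum_prod_type, Finset.sum_comm]
          simp only [Finset.sum_const, Finset.card_univ, nsmul_eq_mul, ← Finset.mul_sum]
          rw [sum_qr_col, mul_assoc]
  refine (opNorm_le_sqrt_of_schur _ (by positivity) (by positivity) hrow hcol).trans (le_of_eq ?_)
  rw [show (Fintype.card o : ℝ) * ε * (Fintype.card o * ε * (1 / (n : ℝ) ^ d)) = (Fintype.card o * ε) ^ 2 * ((n : ℝ) ^ d)⁻¹ by ring,
    Real.sqrt_mul (sq_nonneg _), Real.sqrt_sq (by positivity), Real.sqrt_inv]

omit [Nonempty o] in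
/-- fine × coarse twin of `opNorm_le_of_qr_majorant`. [folklore] -/
theorem opNorm_le_of_qr_majorant' (Y : Matrix ((Tor (fine n M) × Fin d) × o) ((Tor M × Fin d) × o) ℂ) {ε : ℝ} (hε : 0 ≤ ε)
    (hY : ∀ i b, ‖Y i b‖ ≤ ε * qr n M b.1 i.1) : ‖Y‖ ≤ Fintype.card o * ε * (Real.sqrt ((n : ℝ) ^ d))⁻¹ := by
  rw [← Matrix.l2_opNorm_conjTranspose]
  exact opNorm_le_of_qr_majorant n M Yᴴ hε fun b i => by rw [Matrix.conjTranspose_apply, norm_star]; exact hY i b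

omit [Nonempty o] in
/-- **CONJUGATION ACROSS THE TWO LATTICES** (coarse × fine): with a coarse weight `σ` within `L` of the fine weight `ρ` on every block stencil
(`qr(b, i) ≠ 0 → |σ b − ρ i| ≤ L`), `‖X b i‖ ≤ ε·qr(b₁, i₁)` ⇒ `‖W_σ X W_ρ⁻¹ − X‖ ≤ (e^{|κ|L} − 1)·|o|·ε·n^{−d/2}`. [folklore] -/
theorem opNorm_conjMat_sub_le_of_qr_majorant (X : Matrix ((Tor M × Fin d) × o) ((Tor (fine n M) × Fin d) × o) ℂ) {ε : ℝ} (hε : 0 ≤ ε)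
    (hX : ∀ b i, ‖X b i‖ ≤ ε * qr n M b.1 i.1) (hL : 0 ≤ L) (hσ : ∀ b i, qr n M b i ≠ 0 → |σ b - ρ i| ≤ L) (κ : ℝ) :
    ‖conjMat κ (fun b : (Tor M × Fin d) × o => σ b.1) (rhoV n M ρ) X - X‖
      ≤ (Real.exp (|κ| * L) - 1) * (Fintype.card o * ε * (Real.sqrt ((n : ℝ) ^ d))⁻¹) := by
  have hn : (0 : ℝ) < (n : ℝ) ^ d := pow_pos (by exact_mod_cast Nat.pos_of_ne_zero (NeZero.ne n)) d
  have hsupp : ∀ b i, X b i ≠ 0 → |σ b.1 - rhoV n M (o := o) ρ i| ≤ L := by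
    intro b i hbi
    refine hσ b.1 i.1 fun hq => hbi ?_
    have h := hX b i
    rw [hq, mul_zero] at h
    exact norm_le_zero_iff.mp h
  have hrow : ∀ b : (Tor M × Fin d) × o, ∑ i : (Tor (fine n M) × Fin d) × o, ‖X b i‖ ≤ Fintype.card o * ε := by
    intro b
    calc _ ≤ ∑ i : (Tor (fine n M) × Fin d) × o, ε * qr n M b.1 i.1 := Finset.sum_le_sum fun i _ => hX b i
      _ = Fintype.card o * ε := by
          rw [Fintype.sum_prod_type, Finset.sum_comm]
          simp only [Finset.sum_const, Finset.card_univ, nsmul_eq_mul, ← Finset.mul_sum]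
          rw [sum_qr_row, mul_one]
  have hcol : ∀ i : (Tor (fine n M) × Fin d) × o, ∑ b : (Tor M × Fin d) × o, ‖X b i‖ ≤ Fintype.card o * ε * (1 / (n : ℝ) ^ d) := by
    intro i
    calc _ ≤ ∑ b : (Tor M × Fin d) × o, ε * qr n M b.1 i.1 := Finset.sum_le_sum fun b _ => hX b i
      _ = Fintype.card o * ε * (1 / (n : ℝ) ^ d) := by
          rw [Fintype.sum_prod_type, Finset.sum_comm]
          simp only [Finset.sum_const, Finset.card_univ, nsmul_eq_mul, ← Finset.mul_sum]
          rw [sum_qr_col, mul_assoc]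
  refine (opNorm_conjMat_sub_le_schur κ _ _ X hL (by positivity) (by positivity) hsupp hrow hcol).trans (le_of_eq ?_)
  rw [show (Fintype.card o : ℝ) * ε * (Fintype.card o * ε * (1 / (n : ℝ) ^ d)) = (Fintype.card o * ε) ^ 2 * ((n : ℝ) ^ d)⁻¹ by ring,
    Real.sqrt_mul (sq_nonneg _), Real.sqrt_sq (by positivity), Real.sqrt_inv]

omit [Nonempty o] in
/-- fine × coarse twin of `opNorm_conjMat_sub_le_of_qr_majorant` (`W_ρ Y W_σ⁻¹`). [folklore] -/
theorem opNorm_conjMat_sub_le_of_qr_majorant' (Y : Matrix ((Tor (fine n M) × Fin d) × o) ((Tor M × Fin d) × o) ℂ) {ε : ℝ} (hε : 0 ≤ ε)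
    (hY : ∀ i b, ‖Y i b‖ ≤ ε * qr n M b.1 i.1) (hL : 0 ≤ L) (hσ : ∀ b i, qr n M b i ≠ 0 → |σ b - ρ i| ≤ L) (κ : ℝ) :
    ‖conjMat κ (rhoV n M ρ) (fun b : (Tor M × Fin d) × o => σ b.1) Y - Y‖
      ≤ (Real.exp (|κ| * L) - 1) * (Fintype.card o * ε * (Real.sqrt ((n : ℝ) ^ d))⁻¹) := by
  have e : conjMat κ (rhoV n M ρ) (fun b : (Tor M × Fin d) × o => σ b.1) Y - Y
      = (conjMat (-κ) (fun b : (Tor M × Fin d) × o => σ b.1) (rhoV n M ρ) Yᴴ - Yᴴ)ᴴ := by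
    rw [Matrix.conjTranspose_sub, ← conjMat_conjTranspose, Matrix.conjTranspose_conjTranspose]
  rw [e, Matrix.l2_opNorm_conjTranspose]
  have h := opNorm_conjMat_sub_le_of_qr_majorant n M Yᴴ hε (fun b i => by rw [Matrix.conjTranspose_apply, norm_star]; exact hY i b) hL hσ (-κ)
  rwa [abs_neg] at h

omit [Fintype o] [DecidableEq o] [Nonempty o] [NeZero n] hM in
/-- **conjugation defect of a product** from the defects and sizes of its factors: `W(XY)W⁻¹ − XY = (WXW⁻¹ − X)(WYW⁻¹) + X(WYW⁻¹ − Y)`. [folklore] -/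
theorem opNorm_conjMat_mul_sub_le {τ₁ τ₂ τ₃ : Type*} [Fintype τ₁] [DecidableEq τ₁] [Fintype τ₂] [DecidableEq τ₂] [Fintype τ₃] [DecidableEq τ₃]
    (κ : ℝ) (w₁ : τ₁ → ℝ) (w₂ : τ₂ → ℝ) (w₃ : τ₃ → ℝ) (X : Matrix τ₁ τ₂ ℂ) (Y : Matrix τ₂ τ₃ ℂ) {a₁ a₂ b₁ b₂ : ℝ}
    (hX1 : ‖conjMat κ w₁ w₂ X - X‖ ≤ a₁) (hX2 : ‖X‖ ≤ a₂) (hY1 : ‖conjMat κ w₂ w₃ Y - Y‖ ≤ b₁) (hY2 : ‖Y‖ ≤ b₂) :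
    ‖conjMat κ w₁ w₃ (X * Y) - X * Y‖ ≤ a₁ * (b₂ + b₁) + a₂ * b₁ := by
  have ha₁ : 0 ≤ a₁ := (norm_nonneg _).trans hX1
  have ha₂ : 0 ≤ a₂ := (norm_nonneg _).trans hX2
  have hcY : ‖conjMat κ w₂ w₃ Y‖ ≤ b₂ + b₁ := by
    calc ‖conjMat κ w₂ w₃ Y‖ = ‖Y + (conjMat κ w₂ w₃ Y - Y)‖ := by rw [add_sub_cancel]
      _ ≤ b₂ + b₁ := (norm_add_le _ _).trans (add_le_add hY2 hY1)
  have e : conjMat κ w₁ w₃ (X * Y) - X * Y = (conjMat κ w₁ w₂ X - X) * conjMat κ w₂ w₃ Y + X * (conjMat κ w₂ w₃ Y - Y) := by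
    rw [conjMat_mul κ w₁ w₂ w₃, Matrix.sub_mul, Matrix.mul_sub]; abel
  rw [e]
  calc _ ≤ ‖(conjMat κ w₁ w₂ X - X) * conjMat κ w₂ w₃ Y‖ + ‖X * (conjMat κ w₂ w₃ Y - Y)‖ := norm_add_le _ _
    _ ≤ a₁ * (b₂ + b₁) + a₂ * b₁ :=
        add_le_add ((Matrix.l2_opNorm_mul _ _).trans (mul_le_mul hX1 hcY (norm_nonneg _) ha₁))
          ((Matrix.l2_opNorm_mul _ _).trans (mul_le_mul hX2 hY1 (norm_nonneg _) ha₂))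

variable {R₀ : Fin d → (Tor (fine n M) × Fin d → Matrix o o ℂ)} {Γ : ContourSystem d n M} {ℓ : ℕ}

omit [NeZero n] hM in
/-- contour transports of transporters of norm `≤ 1` are within `2` of the identity. [folklore] -/
theorem norm_transport_sub_one_le_two {R' : Fin d → (Tor (fine n M) × Fin d → Matrix o o ℂ)} (hR' : ∀ ν i, ‖R' ν i‖ ≤ 1)
    (μ : Fin d) (Λ : List (Tor (fine n M) × Fin d)) : ‖transport (fine n M) R' μ Λ - 1‖ ≤ 2 := by
  calc _ ≤ ‖transport (fine n M) R' μ Λ‖ + ‖(1 : Matrix o o ℂ)‖ := norm_sub_le _ _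
    _ ≤ 1 + 1 := add_le_add (norm_transport_le_one (fine n M) hR' μ Λ) (by rw [norm_one])
    _ = 2 := by norm_num

/-- **ENTRY MAJORANTS AT THE CHART**: for unitary `R⁰`, contours of length `≤ ℓ`, `δ = ‖A‖e^{‖A‖}`, `E = Etr δ ℓ`: the entries of `Q(R⁰)`,
`Q(e^{A}R⁰) − Q(R⁰)`, `Q(e^{A}R⁰)` are at most `3·qr`, `E·qr`, `(3 + E)·qr`, and the same for the adjoint averagings `Qᴬ((R⁰)ᴴ) = Q(R⁰)ᴴ`,
`Qᴬ((R⁰)⁻¹e^{−A})`. [folklore] -/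
theorem chart_entry_majorants (hR₀ : ∀ ν i, R₀ ν i ∈ Matrix.unitaryGroup o ℂ) (hΓ : ∀ y j μ (t : Fin n), (Γ y j μ t).length ≤ ℓ)
    (A : Fin d → (Tor (fine n M) × Fin d → Matrix o o ℂ)) :
    (∀ b i, ‖Qcov n M Γ R₀ b i‖ ≤ 3 * qr n M b.1 i.1)
      ∧ (∀ b i, ‖(Qcov n M Γ (expChart R₀ A) - Qcov n M Γ R₀) b i‖ ≤ Etr (‖A‖ * Real.exp ‖A‖) ℓ * qr n M b.1 i.1)
      ∧ (∀ b i, ‖Qcov n M Γ (expChart R₀ A) b i‖ ≤ (3 + Etr (‖A‖ * Real.exp ‖A‖) ℓ) * qr n M b.1 i.1)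
      ∧ (∀ i b, ‖QcovA n M Γ (adjOf R₀) i b‖ ≤ 3 * qr n M b.1 i.1)
      ∧ (∀ i b, ‖(QcovA n M Γ (expChartInv R₀ A) - QcovA n M Γ (adjOf R₀)) i b‖ ≤ Etr (‖A‖ * Real.exp ‖A‖) ℓ * qr n M b.1 i.1) := by
  set δ : ℝ := ‖A‖ * Real.exp ‖A‖ with hδdef
  have hδ : 0 ≤ δ := by positivity
  have hE0 : 0 ≤ Etr δ ℓ := Etr_nonneg hδ ℓ
  have hR' : ∀ ν i, ‖R₀ ν i‖ ≤ 1 := fun ν i => (norm_of_unitary (hR₀ ν i)).le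
  have hS' : ∀ ν i, ‖adjOf R₀ ν i‖ ≤ 1 := fun ν i => by rw [adjOf_apply, Matrix.l2_opNorm_conjTranspose]; exact hR' ν i
  have hRR' : ∀ ν i, ‖expChart R₀ A ν i - R₀ ν i‖ ≤ δ := fun ν i => norm_expChart_sub_le hR₀ A ν i
  have hSS' : ∀ ν i, ‖expChartInv R₀ A ν i - adjOf R₀ ν i‖ ≤ δ := fun ν i => norm_expChartInv_sub_le hR₀ A ν i
  have hSSa : ∀ ν i, ‖adjOf (expChartInv R₀ A) ν i - R₀ ν i‖ ≤ δ := fun ν i => by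
    have h : ‖adjOf (expChartInv R₀ A) ν i - adjOf (adjOf R₀) ν i‖ ≤ δ := by
      rw [adjOf_apply, adjOf_apply, ← Matrix.conjTranspose_sub, Matrix.l2_opNorm_conjTranspose]; exact hSS' ν i
    rwa [adjOf_adjOf] at h
  have hT2 : ∀ y j μ (t : Fin n), ‖transport (fine n M) R₀ μ (Γ y j μ t) - 1‖ ≤ 2 := fun y j μ t => norm_transport_sub_one_le_two n M hR' μ _
  have hTR : ∀ y j μ (t : Fin n), ‖transport (fine n M) (expChart R₀ A) μ (Γ y j μ t) - transport (fine n M) R₀ μ (Γ y j μ t)‖ ≤ Etr δ ℓ :=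
    fun y j μ t => norm_transport_sub_transport_le (fine n M) hδ hR' hRR' μ (hΓ y j μ t)
  have hTS : ∀ y j μ (t : Fin n),
      ‖transport (fine n M) (adjOf (expChartInv R₀ A)) μ (Γ y j μ t) - transport (fine n M) R₀ μ (Γ y j μ t)‖ ≤ Etr δ ℓ :=
    fun y j μ t => norm_transport_sub_transport_le (fine n M) hδ hR' hSSa μ (hΓ y j μ t)
  have hT3 : ∀ y j μ (t : Fin n), ‖transport (fine n M) (expChart R₀ A) μ (Γ y j μ t) - 1‖ ≤ 2 + Etr δ ℓ := by
    intro y j μ t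
    calc _ = ‖(transport (fine n M) (expChart R₀ A) μ (Γ y j μ t) - transport (fine n M) R₀ μ (Γ y j μ t))
          + (transport (fine n M) R₀ μ (Γ y j μ t) - 1)‖ := by rw [sub_add_sub_cancel]
      _ ≤ Etr δ ℓ + 2 := (norm_add_le _ _).trans (add_le_add (hTR y j μ t) (hT2 y j μ t))
      _ = 2 + Etr δ ℓ := add_comm _ _
  refine ⟨fun b i => ?_, fun b i => norm_Qcov_sub_Qcov_apply_le n M Γ hE0 hTR b i, fun b i => ?_, fun i b => ?_, fun i b => ?_⟩
  · have h := norm_Qcov_apply_le n M zero_le_two hT2 b i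
    norm_num at h ⊢; exact h
  · have h := norm_Qcov_apply_le n M (by positivity) hT3 b i
    refine h.trans (le_of_eq ?_); ring
  · rw [QcovA_adjOf, Matrix.conjTranspose_apply, norm_star]
    have h := norm_Qcov_apply_le n M zero_le_two hT2 b i
    norm_num at h ⊢; exact h
  · rw [QcovA_eq_conjTranspose, QcovA_eq_conjTranspose, ← Matrix.conjTranspose_sub, Matrix.conjTranspose_apply, norm_star, adjOf_adjOf]
    exact norm_Qcov_sub_Qcov_apply_le n M Γ hE0 hTS b i

/-- **CONJUGATION OF THE AVERAGING CHART PERTURBATION**: for unitary `R⁰`, contours of length `≤ ℓ`, a `1/n`-scale fine weight `ρ` with a coarse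
companion `σ` within `L` on every block stencil: with `θ = e^{|κ|L} − 1`, `E = Etr (‖A‖e^{‖A‖}) ℓ`,
`‖W(Qᴬ(S′)Q(R′) − Q(R⁰)ᴴQ(R⁰))W⁻¹ − (Qᴬ(S′)Q(R′) − Q(R⁰)ᴴQ(R⁰))‖ ≤ n^{−d}·|o|²·θ·E·(2 + θ)·(6 + E)` (`R′ = e^{A}R⁰`, `S′ = (R⁰)⁻¹e^{−A}`). [folklore] -/
theorem opNorm_conjMat_avg_sub_le (hR₀ : ∀ ν i, R₀ ν i ∈ Matrix.unitaryGroup o ℂ) (hΓ : ∀ y j μ (t : Fin n), (Γ y j μ t).length ≤ ℓ)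
    (hL : 0 ≤ L) (hσ : ∀ b i, qr n M b i ≠ 0 → |σ b - ρ i| ≤ L) (κ : ℝ) (A : Fin d → (Tor (fine n M) × Fin d → Matrix o o ℂ)) :
    ‖conjMat κ (rhoV n M ρ) (rhoV n M ρ)
        (QcovA n M Γ (expChartInv R₀ A) * Qcov n M Γ (expChart R₀ A) - QcovA n M Γ (adjOf R₀) * Qcov n M Γ R₀)
      - (QcovA n M Γ (expChartInv R₀ A) * Qcov n M Γ (expChart R₀ A) - QcovA n M Γ (adjOf R₀) * Qcov n M Γ R₀)‖
      ≤ ((n : ℝ) ^ d)⁻¹ * ((Fintype.card o : ℝ) ^ 2 * (Real.exp (|κ| * L) - 1) * Etr (‖A‖ * Real.exp ‖A‖) ℓ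
          * (2 + (Real.exp (|κ| * L) - 1)) * (6 + Etr (‖A‖ * Real.exp ‖A‖) ℓ)) := by
  have hn : (0 : ℝ) < (n : ℝ) ^ d := pow_pos (by exact_mod_cast Nat.pos_of_ne_zero (NeZero.ne n)) d
  set s : ℝ := (Real.sqrt ((n : ℝ) ^ d))⁻¹ with hs
  have hss : s * s = ((n : ℝ) ^ d)⁻¹ := by rw [hs, ← mul_inv, Real.mul_self_sqrt hn.le]
  set θ : ℝ := Real.exp (|κ| * L) - 1 with hθdef
  have hθ : 0 ≤ θ := by rw [hθdef]; linarith [Real.one_le_exp (mul_nonneg (abs_nonneg κ) hL)]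
  set E : ℝ := Etr (‖A‖ * Real.exp ‖A‖) ℓ with hEdef
  have hE : 0 ≤ E := Etr_nonneg (by positivity) ℓ
  set u : ℝ := Fintype.card o * s with hu
  obtain ⟨hQ0, hY1, hQ1, hQh, hX1⟩ := chart_entry_majorants n M hR₀ hΓ A
  set X₁ := QcovA n M Γ (expChartInv R₀ A) - QcovA n M Γ (adjOf R₀) with hX₁
  set Y₁ := Qcov n M Γ (expChart R₀ A) - Qcov n M Γ R₀ with hY₁
  set Q' := Qcov n M Γ (expChart R₀ A) with hQ'
  set Qh := QcovA n M Γ (adjOf R₀) with hQhdef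
  set W := rhoV n M (o := o) ρ with hW
  set V : (Tor M × Fin d) × o → ℝ := fun b => σ b.1 with hV
  have eP : QcovA n M Γ (expChartInv R₀ A) * Qcov n M Γ (expChart R₀ A) - QcovA n M Γ (adjOf R₀) * Qcov n M Γ R₀ = X₁ * Q' + Qh * Y₁ := by
    rw [hX₁, hY₁, Matrix.sub_mul, Matrix.mul_sub]; abel
  -- sizes and defects of the four factors
  have a1 : ‖conjMat κ W V X₁ - X₁‖ ≤ θ * (Fintype.card o * E * s) := opNorm_conjMat_sub_le_of_qr_majorant' n M X₁ hE hX1 hL hσ κ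
  have a2 : ‖X₁‖ ≤ Fintype.card o * E * s := opNorm_le_of_qr_majorant' n M X₁ hE hX1
  have b1 : ‖conjMat κ V W Q' - Q'‖ ≤ θ * (Fintype.card o * (3 + E) * s) := opNorm_conjMat_sub_le_of_qr_majorant n M Q' (by positivity) hQ1 hL hσ κ
  have b2 : ‖Q'‖ ≤ Fintype.card o * (3 + E) * s := opNorm_le_of_qr_majorant n M Q' (by positivity) hQ1
  have c1 : ‖conjMat κ W V Qh - Qh‖ ≤ θ * (Fintype.card o * 3 * s) := opNorm_conjMat_sub_le_of_qr_majorant' n M Qh (by norm_num) hQh hL hσ κ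
  have c2 : ‖Qh‖ ≤ Fintype.card o * 3 * s := opNorm_le_of_qr_majorant' n M Qh (by norm_num) hQh
  have d1 : ‖conjMat κ V W Y₁ - Y₁‖ ≤ θ * (Fintype.card o * E * s) := opNorm_conjMat_sub_le_of_qr_majorant n M Y₁ hE hY1 hL hσ κ
  have d2 : ‖Y₁‖ ≤ Fintype.card o * E * s := opNorm_le_of_qr_majorant n M Y₁ hE hY1
  have h1 := opNorm_conjMat_mul_sub_le κ W V W X₁ Q' a1 a2 b1 b2
  have h2 := opNorm_conjMat_mul_sub_le κ W V W Qh Y₁ c1 c2 d1 d2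
  rw [eP, conjMat_add, add_sub_add_comm]
  refine (norm_add_le _ _).trans ((add_le_add h1 h2).trans (le_of_eq ?_))
  rw [← hss]; ring

/-- **CONJUGATION DEFECT OF THE AVERAGING CHART PERTURBATION**:
`ConjDefect (a′n^d·(Qᴬ(S′)Q(R′) − Q(R⁰)ᴴQ(R⁰))) κ ρ (a′·|o|²·θ·E·(2 + θ)·(6 + E))` (`a′ ≥ 0`). [folklore] -/
theorem conjDefect_avg_chart (hR₀ : ∀ ν i, R₀ ν i ∈ Matrix.unitaryGroup o ℂ) (hΓ : ∀ y j μ (t : Fin n), (Γ y j μ t).length ≤ ℓ)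
    (hL : 0 ≤ L) (hσ : ∀ b i, qr n M b i ≠ 0 → |σ b - ρ i| ≤ L) (κ : ℝ) {a' : ℝ} (ha' : 0 ≤ a')
    (A : Fin d → (Tor (fine n M) × Fin d → Matrix o o ℂ)) :
    ConjDefect ((((a' * (n : ℝ) ^ d : ℝ)) : ℂ) • (QcovA n M Γ (expChartInv R₀ A) * Qcov n M Γ (expChart R₀ A) - QcovA n M Γ (adjOf R₀) * Qcov n M Γ R₀))
      κ (rhoV n M ρ)
      (a' * ((Fintype.card o : ℝ) ^ 2 * (Real.exp (|κ| * L) - 1) * Etr (‖A‖ * Real.exp ‖A‖) ℓ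
          * (2 + (Real.exp (|κ| * L) - 1)) * (6 + Etr (‖A‖ * Real.exp ‖A‖) ℓ))) := by
  have hn : (0 : ℝ) < (n : ℝ) ^ d := pow_pos (by exact_mod_cast Nat.pos_of_ne_zero (NeZero.ne n)) d
  refine conjDefect_of_opNorm ?_
  rw [conjMat_smul, ← smul_sub, norm_smul, Complex.norm_real, Real.norm_of_nonneg (by positivity : (0 : ℝ) ≤ a' * (n : ℝ) ^ d)]
  refine (mul_le_mul_of_nonneg_left (opNorm_conjMat_avg_sub_le n M hR₀ hΓ hL hσ κ A) (by positivity)).trans (le_of_eq ?_)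
  field_simp

end Averaging

end Summit.QuantumFields.BalabanUV.T4Continuum.CovariantVectorChartConjugationAvg

end
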